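import Literature.Claims.NS.Chaabani2020
import Literature.Analysis.FluidPDE.TorusNSSmallDataGlobal
import Literature.Analysis.FluidPDE.TorusClassicalLerayHopfProofs
import Literature.Analysis.FunctionSpaces.TorusClassicalNSUniqueness
import Literature.Analysis.FunctionSpaces.TorusClassicalNSConcatenation
import HarnessLib

/-!
# Solo salvage for claim C22 `Chaabani2020`, part 2: the first clause of Step 7 — a GLOBAL classical
# mean-zero solution on `𝕋³` has uniformly bounded enstrophy

Continuation of `Theorems/SoloSalvageChaabani2020.lean` (seat `ns-claims-salvage-p2`). Step 7 of
`Literature/Claims/NS/Chaabani2020.lean` (implicit at l.284 p.8 with Thm 1.3's class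
`L^∞(0,∞;H¹) ∩ L²(0,∞;H²)`) asserts for every global classical mean-zero solution of the unforced equations on
`𝕋³`: (i) `sup_{t ≥ 0} ‖∇u(t)‖₂² < ∞` and (ii) `∫₀ᵀ‖Δu‖₂² ≤ D` uniformly in `T`. This file proves clause (i)
in the kernel, from tree facts only:

* the energy equality for classical solutions (`Torus.IsClassicalNSSolutionOn.energy_eq`, RRS 2016 Thm 6.5)
  gives `ν∫₀ᵀ‖∇u‖₂² ≤ ½‖u(0)‖₂²`, hence a time `t₀ ≤ T₁` of small enstrophy;
* the small-enstrophy global theorem (`Torus.exists_global_classicalNS_of_small_enstrophy`, RRS 2016 Thm 6.12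
  / Ayala–Protas 2017 (2.11)–(2.12), PROVED in the tree) restarts from `u(t₀)` with an explicit enstrophy
  bound, and forward uniqueness (`Torus.IsClassicalNSSolutionOn.velocity_unique_of_mem`) identifies it with
  `u(t₀ + ·)`;
* on `[0,t₀]` the enstrophy is continuous (`IsSmoothSpaceTimeOn.continuousOn_gradNormSq`).

`step7_bddAbove` — clause (i) of `Step_7`. Clause (ii) (the `L²(0,∞;H²)` bound) needs the `H¹` balance with
the trilinear estimate and is not assembled here. Original sources: Leray 1934 (eventual regularity),
Foias–Temam; RRS 2016 §6. Solo lane.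

WHAT THIS IS NOT: not a claim about NS regularity or blow-up; not a claim about any author beyond the
typed locator.
-/

noncomputable section

open Set MeasureTheory Filter
open scoped RealInnerProductSpace

-- The mandated landing namespace repeats the summit name by design (D-0017).
set_option linter.dupNamespace false

namespace Summit.NavierStokesRegularity.NavierStokesRegularity.Theorems

namespace Chaabani2020

open Literature.Claims.NS.Chaabani2020 Literature.Analysis Literature.Analysis.FluidPDE
  Literature.Analysis.FunctionSpaces

/-- **Step 7, first clause, HOLDS**: a global classical solution of the unforced Navier–Stokes equations on
`𝕋³` (`ν > 0`) with mean-zero slices has `‖∇u(t)‖₂²` bounded on `[0,∞)` (energy equality ⇒ a time of small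
enstrophy before `T₁ = K(u₀)/(νθ) + 1`; small-enstrophy global theorem + forward uniqueness after it;
continuity before it). [cite: Chaabani2020, §2 l.282–284 p.8 with Thm 1.3 l.139–141 p.3]
[cite: RobinsonRodrigoSadowskiCUP2016, Thm 6.12 (p. 108)] -/
theorem step7_bddAbove {ν : ℝ} (hν : 0 < ν)
    {u : ℝ → UnitAddTorus (Fin 3) → EuclideanSpace ℝ (Fin 3)} {p : ℝ → UnitAddTorus (Fin 3) → ℝ}
    (h : Torus.IsClassicalNSSolutionOn (Ici 0) ν 0 u p)
    (hmean : ∀ t : ℝ, 0 ≤ t → Torus.HasZeroMean (u t)) :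
    BddAbove ((fun t => Torus.gradNormSq (u t)) '' Ici 0) := by
  have hd : Fintype.card (Fin 3) = 3 := by simp
  -- the small-enstrophy threshold and the energy budget
  set θ₀ : ℝ := 8 * Real.pi ^ 3 * ν ^ 2 / (3 * Real.sqrt 3) with hθ₀
  have hθ₀pos : 0 < θ₀ := by rw [hθ₀]; positivity
  set θ : ℝ := 2 * θ₀ with hθ
  have hθpos : 0 < θ := by positivity
  set E₀ : ℝ := Torus.kineticEnergy (u 0) with hE₀
  have hE₀ : 0 ≤ E₀ := Torus.kineticEnergy_nonneg _
  set T₁ : ℝ := E₀ / (ν * θ) + 1 with hT₁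
  have hT₁pos : 0 < T₁ := by rw [hT₁]; positivity
  have hcont : ContinuousOn (fun t => Torus.gradNormSq (u t)) (Ici 0) :=
    h.smooth_velocity.continuousOn_gradNormSq (convex_Ici 0) (uniqueDiffOn_Ici 0)
  -- a time of small enstrophy in `[0, T₁]`
  have hsmallt : ∃ t₀ ∈ Icc (0 : ℝ) T₁, Torus.gradNormSq (u t₀) < θ := by
    by_contra hcon
    push Not at hcon
    -- energy equality on `[0, T₁]` with zero force
    have hE := h.energy_eq (convex_Ici 0) hT₁pos.le (fun s hs => mem_Ici.2 hs.1)
    simp only [Pi.zero_apply, inner_zero_left, integral_zero, intervalIntegral.integral_zero,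
      add_zero] at hE
    have hKT : 0 ≤ Torus.kineticEnergy (u T₁) := Torus.kineticEnergy_nonneg _
    -- `θ T₁ ≤ ∫₀^{T₁} ‖∇u‖²`
    have hci : IntervalIntegrable (fun t => Torus.gradNormSq (u t)) volume 0 T₁ :=
      (hcont.mono fun s hs => mem_Ici.2 ((uIcc_of_le hT₁pos.le ▸ hs : s ∈ Icc 0 T₁).1)).intervalIntegrable
    have hlow : θ * T₁ ≤ ∫ t in (0 : ℝ)..T₁, Torus.gradNormSq (u t) := by
      have h1 : ∫ _ in (0 : ℝ)..T₁, θ = θ * T₁ := by simp [mul_comm]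
      rw [← h1]
      exact intervalIntegral.integral_mono_on hT₁pos.le intervalIntegrable_const hci
        (fun t ht => hcon t ht)
    have hbudget : ν * (θ * T₁) ≤ E₀ := by
      have := mul_le_mul_of_nonneg_left hlow hν.le
      linarith
    have hT₁le : T₁ ≤ E₀ / (ν * θ) := by
      rw [le_div_iff₀ (by positivity)]
      linarith
    have : E₀ / (ν * θ) < T₁ := by rw [hT₁]; linarith
    linarith
  obtain ⟨t₀, ht₀, hsmall⟩ := hsmallt
  have ht₀0 : 0 ≤ t₀ := ht₀.1
  -- restart from `u(t₀)` with the small-enstrophy global theorem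
  have hu₀s : Torus.IsSmooth (u t₀) := h.smooth_velocity.isSmooth_slice (mem_Ici.2 ht₀0)
  have hu₀d : Torus.IsDivFree (u t₀) := h.divFree t₀ (mem_Ici.2 ht₀0)
  have hsmall' : torusEnstrophy (u t₀) < 8 * Real.pi ^ 3 * ν ^ 2 / (3 * Real.sqrt 3) := by
    rw [torusEnstrophy, ← hθ₀]
    have : Torus.gradNormSq (u t₀) < 2 * θ₀ := hsmall
    linarith
  obtain ⟨v, q, hv, hv0, -, hvbound⟩ :=
    Torus.exists_global_classicalNS_of_small_enstrophy hd hν hu₀s hu₀d (hmean t₀ ht₀0) hsmall'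
  set B : ℝ := torusEnstrophy (u t₀) /
    (1 - 27 * Torus.kineticEnergy (u t₀) * torusEnstrophy (u t₀) / (2 * Real.pi * ν) ^ 4) with hB
  -- forward uniqueness: `u(t) = v(t − t₀)` for `t ≥ t₀`
  have hv' : Torus.IsClassicalNSSolutionOn (Ici t₀) ν 0 (fun t => v (t - t₀)) (fun t => q (t - t₀)) := by
    have h1 := hv.comp_sub_const t₀
    have hset : ((fun t : ℝ => t - t₀) ⁻¹' Ici (0 : ℝ)) = Ici t₀ := by
      ext t; simp
    rw [hset] at h1
    exact h1
  have hu' : Torus.IsClassicalNSSolutionOn (Ici t₀) ν 0 u p :=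
    h.mono (Ici_subset_Ici.2 ht₀0) (uniqueDiffOn_Ici t₀)
  have hagree : ∀ t : ℝ, t₀ ≤ t → u t = v (t - t₀) := fun t ht =>
    Torus.IsClassicalNSSolutionOn.velocity_unique_of_mem hν.le (convex_Ici t₀) hu' hv'
      (mem_Ici.2 le_rfl) (by simp [hv0]) (mem_Ici.2 ht) ht
  -- the bound on `[0, t₀]` by continuity
  obtain ⟨B₀, hB₀⟩ : BddAbove ((fun t => Torus.gradNormSq (u t)) '' Icc 0 t₀) :=
    isCompact_Icc.bddAbove_image (hcont.mono fun s hs => mem_Ici.2 hs.1)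
  refine ⟨max B₀ (2 * B), ?_⟩
  rintro _ ⟨t, ht, rfl⟩
  rcases le_or_gt t t₀ with hle | hgt
  · exact (hB₀ ⟨t, ⟨mem_Ici.1 ht, hle⟩, rfl⟩).trans (le_max_left _ _)
  · have h1 : Torus.gradNormSq (u t) = 2 * torusEnstrophy (v (t - t₀)) := by
      rw [hagree t hgt.le, torusEnstrophy]; ring
    show Torus.gradNormSq (u t) ≤ max B₀ (2 * B)
    rw [h1]
    have h2 := hvbound (t - t₀) (by linarith)
    exact (mul_le_mul_of_nonneg_left h2 (by norm_num)).trans (le_max_right _ _)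

end Chaabani2020

end Summit.NavierStokesRegularity.NavierStokesRegularity.Theorems
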